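import Summits.ABC.FunctionField.TransferSheetLadder
import Summits.ABC.FunctionField.TransferSheetWindow
import Literature.Barriers.ABC.SzpiroEpsilonCannotBeDroppedProofs
import Literature.Barriers.ABC.MasonStothersFailsInCharP
import HarnessLib
import HarnessLib.Audit

/-!
# Cell abc-ff — transfer sheet, chain (e) PERFECTOID / TILTING: the ONE comparison statement
# (row CF-8 = `R_PF`) typed, and why it is NO DOOR (a typed null, for the record)

`Summits/ABC/FunctionField/TransferSheetPerfectoid.lean` (cell abc-ff; mathematics and Lean by the
cell's PERFECTOID lens seat abc-ff-lens-6, `HOME/lens-6/Sketch_PF.lean` v1.2 sha16 `6d61a7946331a0b3`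
+ `PF-STEPS.md` v1.3 §§0–4, farm rc 0; graded by referee B in `HOME/ref-2/REF-B-v0.8.md`: «VERDICT
CF-8: NO DOOR — PASS as a typed null»; re-pointed to the tree decls and landed by the typer seat).
HONESTY: abc is not proved by any of this; A-PS (`|Δ_min(E)| ≤ C·N(E)^K` for all `E/ℚ`, fixed `K`) is
NOT abc — «NOT abc — POLY-SZPIRO(E)» (D-0139/D-0140); every `def … : Prop` tagged `@[conjecture]`
below is a requirement SHAPE used only as a hypothesis, or refuted as typed; typed ≠ proved; a
primary is a source, not an endorsement; no side taken on [IUTchIII] Cor. 3.12.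

## The question and the answer (lens-6, PF-STEPS §0)
KEY question of the parcel: is there a printed statement (tilting / prismatic / Fargues–Fontaine /
Kedlaya–Liu) in which the characteristic-`p` Mason–Stothers-type inequality has a characteristic-`0`
shadow whose DEFECT is controlled by conductor-side data? ANSWER: NO (null with queries, cell file
`lens-6/REDUCTIONS-PF.md` RC-PF3), and the structural reason is typed here. The tilt transports
exactly ONE arithmetic quantity of `E/ℚ` at ONE place — the valuation of the Tate parameter,
`n_p := ord_p Δ_min(E) = v_p(q) = v(q♭)` (tilting preserves valuations; `|Δ(E_q)| = |q|`, Silverman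
ATAEC Thm V.3.1(b)) — and every defect the comparison names at `p` (conductor exponent `f_p`;
different / discriminant exponent of `ℚ_p(E[p^k]) = ℚ_p(ζ_{p^k}, q^{1/p^k})`; Hodge–Tate weights
`{0,1}`; Fargues–Fontaine degree; `p`-torsion defect of the `A_inf` / prismatic comparison) is BOUNDED
INDEPENDENTLY OF THE HEIGHT `n_p`. Hence:
* **CF-8(loc)** `LocalSzpiroAt v K C` — «`ord_v Δ_min(E) ≤ K · f_v(E) + C` for all semistable `E/ℚ`»,
  the shape ANY place-bound comparison produces — is **FALSE at EVERY place, for every `K, C`**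
  (`not_localSzpiroAt`, kernel; witness = the tree's Bennett–Yazdani / Masser family
  `y² + xy + p^k y = x³`: elliptic, semistable, `ord_p Δ_min ≥ 3k`, `f_p = 1`); so is its uniform form
  (`not_localSzpiroWith`), and NO place-wise defect functional can be a door (`no_local_defect_door`).
* **CF-8(glob)** `DefectDoorWith K` — «SOME real functional `D(E)` dominates `log|Δ_min(E)|` and is
  `≤ K log N_E + C`» — **is LITERALLY `PolySzpiroWith K`** (`defectDoorWith_iff`, junk witness
  `D = log|Δ_min|`), i.e. rung A-PS RESTATED, `(∃ K, DefectDoorWith K) ↔ Summit.ABC.PolySzpiroRat`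
  (`exists_defectDoorWith_iff`): «NOT abc — POLY-SZPIRO(K)», open for `K > 6`, FALSE as typed for
  `K ≤ 6` (`not_defectDoorWith_of_le_six`, via the sheet's window guard
  `not_polySzpiroWith_of_le_six` = Masser 1990; REF-B v0.8 label fix) — not a new opening. A NAMED
  `D` is a door only through extra structure: (α) global including `∞`, (β) not place-wise
  conductor-dominated, (γ) an independent construction with its own size theory (else
  `defectDoorWith_iff` makes it A-PS in costume, and a `6+ε` size theory makes it `R_KS ⟺ abc` by
  `rks_iff_abc`), (δ) it must separate the family `W_{p,k}` from squarefree-conductor curves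
  (PF-STEPS §4, endorsed by REF-B as the acceptance test for any future «`p`-adic comparison defect ⇒
  Szpiro» card).
* **PF-4** `FrobeniusShadowEmptyAt p` (dictionary / annex row, GCD-type currency, used as a hypothesis
  NOWHERE): the only integer shadow of the characteristic-`p` defect — the Frobenius-descent depth
  `p^m` of `Literature.Barriers.ABC.natDegree_lt_of_frobenius_descent` /
  `Literature.Barriers.ABC.no_degree_bound_charP` (`deg a < p^m · deg rad(abc)`, `p^m ∣ deg a`) — is
  «`p ∣ ord_v Δ_min(E)` at every place», whose emptiness among semistable curves is a THEOREM in print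
  for `p ≥ 11` (Mazur + Serre's level/weight + Ribet) and FALSE at `p = 5` (`11a1`, `Δ_min = −11⁵`) and
  at `p = 1` (`not_frobeniusShadowEmptyAt_one`, kernel); it constrains divisibility of the exponent
  vector `(ord_ℓ Δ)_ℓ`, never its size — no bearing on A0 / A-PS (REF-B: AGREE).

A0: nothing. A-PS: nothing new. The parcel's census rows RC-PF1…4 stand as struck / annexed by the
REDUCTION-CENSUS desk. Deliberately NOT here: any perfectoid OBJECT (Mathlib has no perfectoid spaces,
tilting or prismatic cohomology — and none is needed for the verdict, which is about the SHAPE of the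
output); any restatement of `PolySzpiroWith` / `Summit.ABC.PolySzpiroRat` (cited by name).
-/

noncomputable section

namespace Summit.ABC.FunctionField

open IsDedekindDomain WeierstrassCurve Rat.HeightOneSpectrum

/-! ## CF-8(loc): the per-place («tilted») Szpiro comparison and its failure at every place -/

/-- **Row CF-8(loc) at a place `v` — «local Szpiro with a conductor-side defect»:** for every
SEMISTABLE elliptic `E/ℚ`, `ord_v Δ_min(E) ≤ K · f_v(E) + C` (`WeierstrassCurve.ordMinimalDiscriminant`,
`WeierstrassCurve.conductorExponent`). This is the shape any place-bound (perfectoid / `p`-adic Hodge)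
comparison produces: the tilt sees exactly one place and transports `n_v = v(q)` exactly, and every
defect it names at `v` (conductor exponent, different of `ℚ_v(E[p^n])`, Hodge–Tate weights) is bounded
by a function of `f_v` and the level. Typed FOR THE RECORD as a refuted shape: FALSE for every
`v, K, C` (`not_localSzpiroAt`). Lens-6, PF-STEPS §3. [folklore] -/
@[conjecture] def LocalSzpiroAt (v : HeightOneSpectrum ℤ) (K C : ℝ) : Prop :=
  ∀ (W : WeierstrassCurve ℚ) [W.IsElliptic], W.IsSemistable ℤ →
    (W.ordMinimalDiscriminant v : ℝ) ≤ K * (W.conductorExponent v : ℝ) + C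

/-- **The per-place comparison fails at EVERY place (PROVED, lens-6)** — the Tate-curve phenomenon in
the tree's currency: for `p` the prime of `v` and `k ≥ 1`, the curve `y² + xy + p^k y = x³` is elliptic,
globally minimal and semistable with `ord_p Δ_min ≥ 3k` and `f_p = 1` (tree:
`Literature.Barriers.ABC.BennettYazdani.le_ordMinimalDiscriminant_mk_iff`, `….conductorExponent_mk_eq`,
`….isSemistableAt_mk`, the Masser / Bennett–Yazdani family of `SzpiroEpsilonCannotBeDroppedProofs`).
Take `k = ⌈K + C⌉₊ + 1`. So no `K, C` work, at any single place. [folklore] -/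
theorem not_localSzpiroAt (v : HeightOneSpectrum ℤ) (K C : ℝ) : ¬ LocalSzpiroAt v K C := by
  intro h
  set p : ℕ := natGenerator v with hp
  have hpp : p.Prime := prime_natGenerator v
  set k : ℕ := ⌈K + C⌉₊ + 1 with hk
  have hk0 : k ≠ 0 := by omega
  have hb : (p : ℤ) ^ k ≠ 0 := pow_ne_zero _ (by exact_mod_cast hpp.ne_zero)
  have hc : IsCoprime (1 : ℤ) ((p : ℤ) ^ k) := isCoprime_one_left
  have h3 : ¬ (3 : ℤ) ∣ 1 := by norm_num
  have hab : (1 : ℤ) ^ 3 - 27 * (p : ℤ) ^ k ≠ 0 := by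
    have h1 : (1 : ℤ) ≤ (p : ℤ) ^ k := one_le_pow₀ (by exact_mod_cast hpp.one_lt.le)
    intro h0
    rw [one_pow] at h0
    linarith
  haveI := Literature.Barriers.ABC.BennettYazdani.isElliptic_mk hb hab
  have hdvd : (p : ℤ) ∣ ((p : ℤ) ^ k) ^ 3 * ((1 : ℤ) ^ 3 - 27 * (p : ℤ) ^ k) :=
    dvd_mul_of_dvd_left (dvd_pow (dvd_pow_self (p : ℤ) hk0) (by norm_num)) _
  -- `ord_p Δ_min ≥ 3k`
  have hord : 3 * k ≤ ((WeierstrassCurve.mk (1 : ℤ) 0 ((p : ℤ) ^ k) 0 0).baseChange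
      ℚ).ordMinimalDiscriminant v := by
    rw [Literature.Barriers.ABC.BennettYazdani.le_ordMinimalDiscriminant_mk_iff hc h3 hb hab v
      (3 * k), ← hp]
    refine dvd_mul_of_dvd_left ?_ _
    rw [← pow_mul, mul_comm]
  -- `f_p = 1`
  have hf : ((WeierstrassCurve.mk (1 : ℤ) 0 ((p : ℤ) ^ k) 0 0).baseChange ℚ).conductorExponent v
      = 1 := by
    have e := Literature.Barriers.ABC.BennettYazdani.conductorExponent_mk_eq hc h3 hb hab v
    rw [← hp, if_pos hdvd] at e
    exact e
  -- semistable
  have hss : ((WeierstrassCurve.mk (1 : ℤ) 0 ((p : ℤ) ^ k) 0 0).baseChange ℚ).IsSemistable ℤ :=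
    fun w => Literature.Barriers.ABC.BennettYazdani.isSemistableAt_mk hc h3 hb hab w
  have h1 := h ((WeierstrassCurve.mk (1 : ℤ) 0 ((p : ℤ) ^ k) 0 0).baseChange ℚ) hss
  rw [hf] at h1
  have h2 : ((3 * k : ℕ) : ℝ) ≤
      (((WeierstrassCurve.mk (1 : ℤ) 0 ((p : ℤ) ^ k) 0 0).baseChange ℚ).ordMinimalDiscriminant v
        : ℝ) := by
    exact_mod_cast hord
  have h3' : K + C ≤ (⌈K + C⌉₊ : ℝ) := Nat.le_ceil _
  have hk' : (k : ℝ) = (⌈K + C⌉₊ : ℝ) + 1 := by rw [hk]; push_cast; ring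
  push_cast at h1 h2
  linarith

/-- **Row CF-8(loc), uniform form** — the same comparison at EVERY place simultaneously (what a «tilt
at every prime separately» would give). Typed for the record; also false (already at any single
place, `not_localSzpiroWith`). [folklore] -/
@[conjecture] def LocalSzpiroWith (K C : ℝ) : Prop :=
  ∀ v : HeightOneSpectrum ℤ, LocalSzpiroAt v K C

/-- The uniform per-place comparison is false for every `K, C` (instantiate `not_localSzpiroAt` at
the place `2`). PROVED (lens-6). [folklore] -/
theorem not_localSzpiroWith (K C : ℝ) : ¬ LocalSzpiroWith K C := fun h =>
  not_localSzpiroAt ((primesEquiv (R := ℤ)).symm ⟨2, Nat.prime_two⟩) K C (h _)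

/-- **No per-place defect door (PROVED, lens-6; rows PF-2 / PF-6 typed).** If a place-wise defect
`d(E, v)` (different / conductor / Hodge–Tate / ramification data of the `p`-adic or tilted tower at
`v`) dominates the local height `ord_v Δ_min` on semistable curves and is itself `≤ K f_v + C`,
contradiction — at any single place. This is the typed form of «every defect the perfectoid
comparison names at `p` is bounded independently of the height ⇒ no door». [folklore] -/
theorem no_local_defect_door (v : HeightOneSpectrum ℤ) (K C : ℝ)
    (d : WeierstrassCurve ℚ → HeightOneSpectrum ℤ → ℝ)
    (hdom : ∀ (W : WeierstrassCurve ℚ) [W.IsElliptic], W.IsSemistable ℤ →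
      (W.ordMinimalDiscriminant v : ℝ) ≤ d W v)
    (hbd : ∀ (W : WeierstrassCurve ℚ) [W.IsElliptic], W.IsSemistable ℤ →
      d W v ≤ K * (W.conductorExponent v : ℝ) + C) : False :=
  not_localSzpiroAt v K C fun W _ hW => (hdom W hW).trans (hbd W hW)

/-! ## CF-8(glob): the global «defect door» is rung A-PS in costume -/

/-- **Row CF-8(glob) — «defect door with exponent `K`»:** SOME real functional `D(E)` (a
log-different, the log-discriminant of a division field / perfectoid tower, a degree on a
Fargues–Fontaine-type object, …) dominates `log|Δ_min(E)|` AND is `≤ K log N_E + C`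
(`minimalDiscriminantNorm ℤ`, `conductorNorm ℤ`). The interface is inhabited by the junk functional
`D := log|Δ_min|` exactly when `PolySzpiroWith K` holds (`defectDoorWith_iff`): as an `∃`-statement it
is rung A-PS RESTATED («NOT abc — POLY-SZPIRO(K)»: open for `K > 6`, FALSE for `K ≤ 6`,
`not_defectDoorWith_of_le_six`), not a new opening; a named `D` is a door only through extra
structure (an independent construction + its own size theory; PF-STEPS §4 (α)–(δ)). CONJECTURAL
SHAPE, used only as a hypothesis; D-0139/D-0140. Lens-6. [folklore] -/
@[conjecture] def DefectDoorWith (K : ℝ) : Prop :=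
  ∃ D : WeierstrassCurve ℚ → ℝ,
    (∀ (W : WeierstrassCurve ℚ) [W.IsElliptic], Real.log (W.minimalDiscriminantNorm ℤ : ℝ) ≤ D W) ∧
      ∃ C : ℝ, ∀ (W : WeierstrassCurve ℚ) [W.IsElliptic],
        D W ≤ K * Real.log (W.conductorNorm ℤ : ℝ) + C

/-- **The squeeze (PROVED, lens-6): a defect door with exponent `K` IS `PolySzpiroWith K`** — both
directions, two lines (`→`: compose the two bounds; `←`: the junk witness `D = log|Δ_min|`). [folklore] -/
theorem defectDoorWith_iff (K : ℝ) : DefectDoorWith K ↔ PolySzpiroWith K := by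
  constructor
  · rintro ⟨D, hdom, C, hbd⟩
    exact ⟨C, fun W _ => (hdom W).trans (hbd W)⟩
  · rintro ⟨C, hC⟩
    exact ⟨fun W => Real.log (W.minimalDiscriminantNorm ℤ : ℝ), fun W _ => le_rfl, C,
      fun W _ => hC W⟩

/-- Hence a defect door (any exponent) gives exactly rung A-PS BY NAME, `Summit.ABC.PolySzpiroRat`
(through the sheet's `polySzpiroRat_of_polySzpiroWith`, `TransferSheetLadder.lean`) — «NOT abc —
POLY-SZPIRO(K)». PROVED (lens-6). [folklore] -/
theorem polySzpiroRat_of_defectDoorWith {K : ℝ} (h : DefectDoorWith K) : Summit.ABC.PolySzpiroRat :=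
  polySzpiroRat_of_polySzpiroWith ((defectDoorWith_iff K).mp h)

/-- … and conversely A-PS inhabits the door interface (junk witness `D = log|Δ_min|`), so the door is
not weaker than A-PS either: `(∃ K, DefectDoorWith K) ↔ Summit.ABC.PolySzpiroRat`. PROVED (lens-6).
[folklore] -/
theorem exists_defectDoorWith_iff : (∃ K, DefectDoorWith K) ↔ Summit.ABC.PolySzpiroRat := by
  constructor
  · rintro ⟨K, h⟩
    exact polySzpiroRat_of_defectDoorWith h
  · rintro ⟨K, C, h⟩
    exact ⟨K, (defectDoorWith_iff K).mpr ⟨C, fun W _ => h W⟩⟩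

/-- **Window guard (REF-B v0.8 label fix): the global defect door is FALSE as typed for `K ≤ 6`** —
Masser 1990 via the sheet's window guard `not_polySzpiroWith_of_le_six` (`TransferSheetWindow.lean`,
tree `Literature.Barriers.ABC.not_szpiro_epsilon_zero_holds`). So `DefectDoorWith K` is conjectural
exactly on `K > 6`. [cite: Masser1990, Theorem] -/
theorem not_defectDoorWith_of_le_six {K : ℝ} (hK : K ≤ 6) : ¬ DefectDoorWith K :=
  fun h => not_polySzpiroWith_of_le_six hK ((defectDoorWith_iff K).1 h)

/-! ## PF-4: the integer shadow of the characteristic-`p` defect (Frobenius-descent depth) -/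

/-- **Row PF-4 — «Frobenius shadow empty at `p`»** (dictionary / annex row, GCD-type currency; a plain
predicate, used as a hypothesis NOWHERE and asserted NOWHERE). Characteristic `p`: every coprime
solution descends `a = a₀(X^{p^m})`, and the Frobenius family `(a₀^p, b₀^p, c₀^p)` (all multiplicities
divisible by `p`) is non-empty of unbounded degree (`Literature.Barriers.ABC.no_degree_bound_charP`,
`Literature.Barriers.ABC.natDegree_lt_of_frobenius_descent`). Over `ℚ` the shadow of «all
multiplicities divisible by `p`» is «`p ∣ ord_v Δ_min(E)` at every place `v`» — by Tate-curve inertia,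
`E[p]` unramified at every bad `ℓ ≠ p` and finite at `p` (Frey; Silverman ATAEC Ex. V.5.13(b)). This
Prop says that shadow is EMPTY among semistable curves. STATUS, in words only: a theorem in print for
every prime `p ≥ 11` (`p ∉ Literature.NumberTheory.EllipticCurves.mazurPrimes`: `E[p]` irreducible by
Mazur, modularity, Serre's level/weight for semistable `E`, Ribet's level lowering ⇒ a weight-2 form
of level 1: none); FALSE at `p = 5` (`11a1`: semistable, `Δ_min = −11⁵`) and at `p = 1`
(`not_frobeniusShadowEmptyAt_one`); at `p = 0` it reads «every semistable `E/ℚ` has a bad place»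
(`frobeniusShadowEmptyAt_zero_iff`). CURRENCY: it constrains the `p`-divisibility of the exponent
vector `(ord_ℓ Δ)_ℓ`, never its size — in print strictly DOWNSTREAM of the height conjecture (Frey:
Height Conjecture ⇒ Asymptotic Fermat), so it is no door to `PolySzpiroWith K`; compare
`not_localSzpiroAt` (sizes are unconstrained place by place). Lens-6. [folklore] -/
def FrobeniusShadowEmptyAt (p : ℕ) : Prop :=
  ∀ (W : WeierstrassCurve ℚ) [W.IsElliptic], W.IsSemistable ℤ →
    ∃ v : HeightOneSpectrum ℤ, ¬ (p ∣ W.ordMinimalDiscriminant v)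

/-- Junk guard (PROVED, lens-6): at `p = 1` the shadow is everything, so the Prop is false (witness:
the semistable curve `y² + xy + 2y = x³` of the tree's Bennett–Yazdani family). [folklore] -/
theorem not_frobeniusShadowEmptyAt_one : ¬ FrobeniusShadowEmptyAt 1 := by
  intro h
  have hb : (2 : ℤ) ^ 1 ≠ 0 := by norm_num
  have hc : IsCoprime (1 : ℤ) ((2 : ℤ) ^ 1) := isCoprime_one_left
  have h3 : ¬ (3 : ℤ) ∣ 1 := by norm_num
  have hab : (1 : ℤ) ^ 3 - 27 * (2 : ℤ) ^ 1 ≠ 0 := by norm_num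
  haveI := Literature.Barriers.ABC.BennettYazdani.isElliptic_mk hb hab
  have hss : ((WeierstrassCurve.mk (1 : ℤ) 0 ((2 : ℤ) ^ 1) 0 0).baseChange ℚ).IsSemistable ℤ :=
    fun w => Literature.Barriers.ABC.BennettYazdani.isSemistableAt_mk hc h3 hb hab w
  obtain ⟨v, hv⟩ := h ((WeierstrassCurve.mk (1 : ℤ) 0 ((2 : ℤ) ^ 1) 0 0).baseChange ℚ) hss
  exact hv (one_dvd _)

/-- Junk guard (PROVED): at `p = 0` the Prop reads «every semistable elliptic curve over `ℚ` has a
place of bad reduction» (true — Tate/Ogg/Fontaine: no elliptic curve over `ℤ` — but not proved here).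
[folklore] -/
theorem frobeniusShadowEmptyAt_zero_iff : FrobeniusShadowEmptyAt 0 ↔
    ∀ (W : WeierstrassCurve ℚ) [W.IsElliptic], W.IsSemistable ℤ →
      ∃ v : HeightOneSpectrum ℤ, W.ordMinimalDiscriminant v ≠ 0 := by
  simp only [FrobeniusShadowEmptyAt, zero_dvd_iff, ne_eq]

end Summit.ABC.FunctionField

end
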